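import Mathlib
import HarnessLib

/-!
# Route `PrimeLevelFamEdge`, crux K_B (stmt-Parity-20343), line `diagonal_kernel_split`, helper H1
# (`CornerNegligibleXSq`), part 1: the diagonal cut-off weight `𝒲` and the corner weight `E`

The TRUE Petersson diagonal of the mollified second moment carries the weight
`𝒲(y) = Σ_{n≥1} W(n²y)/n`, `W(y) = (1/2πi)∫_{(3)} Γ(1+t)² y^{-t} dt/t = ∫_0^∞ e^{-u-y/u} du`
([KowalskiMichelVanderKam2000] §3, p. 12 display at `k = 0`; Prop. 5.1), which in real form is the
single integral `𝒲(y) = ∫_0^∞ dv/(e^{v + y/v} − 1)` (sum the geometric series after `u = nv`). The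
CONTINUED KMV kernel `KMV2000.kmvKernel` keeps only the `t = 0` residue `½ log(1/y)`. The corner weight
is the difference `E(y) := 𝒲(y) − ½ log(1/y) = 𝒲(y) + ½ log y`. This file and its continuation
`CornerWeightE.lean` prove, by real-variable means only (no Mellin transform):
* `E(y) = ∫_0^∞ [r(v + y/v) − r(v)] dv` with `r(x) = 1/(eˣ − 1) − 1/x` (`cornerE_eq_integral`), from the
  three explicit integrals `∫ dv/(e^{v+y/v} − 1) = 𝒲(y)`, `∫ [v/(v²+y) − v/(v²+1)] dv = −½ log y`,
  `∫ [r(v) + v/(v²+1)] dv = 0` (so the constant term vanishes — «the `γ`'s cancel»);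
* `r` is increasing with `−½ ≤ r ≤ 0` (`monotoneOn_rFun`, `neg_half_le_rFun`, `rFun_nonpos`);
* hence `0 ≤ E`, `E` is monotone, `E(y) ≤ √y` (`cornerE_nonneg`, `cornerE_mono`, `cornerE_le_sqrt`: split
  at `v = √y`, shift `v ↦ v + √y` on the tail), and `E(y) ≤ 𝒲(1) + ½ log y` for `y ≥ 1`.
These are the only properties of `E` used by the corner estimate. Pure real analysis over Mathlib;
nothing about L-functions is asserted. «The programme SEARCHES and TYPES; no claim about Landau–Siegel
zeros, Theorems 1–2 of arXiv:2211.02515 or a repaired Margin232 until a kernel theorem says so.»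
-/

noncomputable section

open Real Set MeasureTheory Filter Topology

namespace Summit.Parity.GeneralizedHardyLittlewood.Theorems.BeyondDiagonalBeatsQuarter.Corner

/-! ## The function `r(x) = 1/(eˣ − 1) − 1/x` -/

/-- `r(x) = 1/(eˣ − 1) − 1/x`, the regular part of the Bose kernel at the origin.
[cite: KowalskiMichelVanderKam2000, Prop. 5.1 — derivation (real form of the diagonal weight)] -/
def rFun (x : ℝ) : ℝ := (Real.exp x - 1)⁻¹ - x⁻¹

/-- `r(x) ≤ 0` for `x > 0` (`eˣ − 1 ≥ x`). [folklore] -/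
theorem rFun_nonpos {x : ℝ} (hx : 0 < x) : rFun x ≤ 0 := by
  unfold rFun
  have h1 : x ≤ Real.exp x - 1 := by have := Real.add_one_lt_exp hx.ne'; linarith
  have h2 : (Real.exp x - 1)⁻¹ ≤ x⁻¹ := by
    rw [inv_le_inv₀ ((sub_pos.2 (Real.one_lt_exp_iff.2 hx))) hx]
    exact h1
  linarith

/-- `(2 − x)eˣ ≤ 2 + x` for `x ≥ 0` (the `[1/1]` Padé bound; `g(x) = (2−x)eˣ − x − 2` has `g(0) = 0`,
`g′(x) = (1−x)eˣ − 1 ≤ 0`). [folklore] -/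
theorem two_sub_mul_exp_le {x : ℝ} (hx : 0 ≤ x) : (2 - x) * Real.exp x ≤ 2 + x := by
  let g : ℝ → ℝ := fun t ↦ (2 - t) * Real.exp t - t - 2
  have hderiv : ∀ t, HasDerivAt g ((1 - t) * Real.exp t - 1) t := by
    intro t
    have h1 : HasDerivAt (fun t ↦ (2 - t) * Real.exp t)
        ((0 - 1) * Real.exp t + (2 - t) * Real.exp t) t :=
      ((hasDerivAt_const t (2 : ℝ)).sub (hasDerivAt_id t)).mul (Real.hasDerivAt_exp t)
    have h2 : HasDerivAt g ((0 - 1) * Real.exp t + (2 - t) * Real.exp t - 1 - 0) t :=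
      (h1.sub (hasDerivAt_id t)).sub (hasDerivAt_const t (2 : ℝ))
    convert h2 using 1
    ring
  have hanti : AntitoneOn g (Ici 0) := by
    refine antitoneOn_of_deriv_nonpos (convex_Ici 0) ?_ ?_ ?_
    · exact fun t _ ↦ (hderiv t).continuousAt.continuousWithinAt
    · exact fun t _ ↦ (hderiv t).differentiableAt.differentiableWithinAt
    · intro t ht
      rw [interior_Ici] at ht
      rw [(hderiv t).deriv]
      have h := Real.add_one_le_exp (-t)
      have hpos := Real.exp_pos t
      have : (1 - t) * Real.exp t ≤ Real.exp (-t) * Real.exp t :=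
        mul_le_mul_of_nonneg_right (by linarith) hpos.le
      rw [← Real.exp_add, neg_add_cancel, Real.exp_zero] at this
      linarith
  have h0 : g 0 = 0 := by simp [g]
  have := hanti (self_mem_Ici : (0 : ℝ) ∈ Ici 0) (mem_Ici.2 hx) hx
  rw [h0] at this
  simp only [g] at this
  linarith

/-- `r(x) ≥ −½` for `x > 0`. [folklore] -/
theorem neg_half_le_rFun {x : ℝ} (hx : 0 < x) : -(1 / 2) ≤ rFun x := by
  unfold rFun
  have hpos : 0 < Real.exp x - 1 := (sub_pos.2 (Real.one_lt_exp_iff.2 hx))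
  rcases le_or_gt 2 x with h2 | h2
  · have h1 : 0 < (Real.exp x - 1)⁻¹ := inv_pos.2 hpos
    have h3 : x⁻¹ ≤ 1 / 2 := by
      rw [inv_eq_one_div, div_le_div_iff₀ hx (by norm_num)]
      linarith
    linarith
  · have hE := two_sub_mul_exp_le hx.le
    have h2x : 0 < 2 - x := by linarith
    have h4 : (2 - x) * (Real.exp x - 1) ≤ 1 * (2 * x) := by nlinarith
    have h5 : x⁻¹ - 1 / 2 = (2 - x) / (2 * x) := by field_simp
    have h6 : (2 - x) / (2 * x) ≤ 1 / (Real.exp x - 1) := by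
      rw [div_le_div_iff₀ (by positivity) hpos]
      exact h4
    rw [← inv_eq_one_div] at h6
    linarith

/-- `|r(x)| ≤ ½` for `x > 0`. [folklore] -/
theorem abs_rFun_le {x : ℝ} (hx : 0 < x) : |rFun x| ≤ 1 / 2 :=
  abs_le.2 ⟨neg_half_le_rFun hx, (rFun_nonpos hx).trans (by norm_num)⟩

/-- `x² ≤ eˣ + e⁻ˣ − 2` for `x ≥ 0` (`2 cosh x − 2 ≥ x²`: the derivative `2 sinh x − 2x` is `≥ 0`). [folklore] -/
theorem sq_le_exp_add_exp_neg_sub_two {x : ℝ} (hx : 0 ≤ x) :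
    x ^ 2 ≤ Real.exp x + Real.exp (-x) - 2 := by
  let k : ℝ → ℝ := fun t ↦ Real.exp t + Real.exp (-t) - 2 - t ^ 2
  have hderiv : ∀ t, HasDerivAt k (Real.exp t - Real.exp (-t) - 2 * t) t := by
    intro t
    have h1 : HasDerivAt (fun t ↦ Real.exp (-t)) (Real.exp (-t) * (-1)) t :=
      (Real.hasDerivAt_exp (-t)).comp t ((hasDerivAt_id t).neg)
    have h2 : HasDerivAt (fun t ↦ t ^ 2) (2 * t) t := by
      simpa using hasDerivAt_pow 2 t
    have h3 := (((Real.hasDerivAt_exp t).add h1).sub (hasDerivAt_const t (2 : ℝ))).sub h2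
    exact h3.congr_deriv (by ring)
  have hmono : MonotoneOn k (Ici 0) := by
    refine monotoneOn_of_deriv_nonneg (convex_Ici 0) ?_ ?_ ?_
    · exact fun t _ ↦ (hderiv t).continuousAt.continuousWithinAt
    · exact fun t _ ↦ (hderiv t).differentiableAt.differentiableWithinAt
    · intro t ht
      rw [interior_Ici] at ht
      rw [(hderiv t).deriv]
      have hs : t ≤ Real.sinh t := Real.self_le_sinh_iff.2 (le_of_lt ht)
      rw [Real.sinh_eq] at hs
      linarith
  have h0 : k 0 = 0 := by norm_num [k]
  have := hmono (self_mem_Ici : (0 : ℝ) ∈ Ici 0) (mem_Ici.2 hx) hx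
  rw [h0] at this
  simp only [k] at this
  linarith

/-- The derivative of `r` on `(0, ∞)`: `r′(x) = −eˣ/(eˣ−1)² + 1/x²`. [folklore] -/
theorem hasDerivAt_rFun {x : ℝ} (hx : 0 < x) :
    HasDerivAt rFun (-(Real.exp x) / (Real.exp x - 1) ^ 2 + (x ^ 2)⁻¹) x := by
  unfold rFun
  have hne : Real.exp x - 1 ≠ 0 := ((sub_pos.2 (Real.one_lt_exp_iff.2 hx))).ne'
  have h1 : HasDerivAt (fun x ↦ Real.exp x - 1) (Real.exp x) x := by
    simpa using (Real.hasDerivAt_exp x).sub_const 1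
  have h2 : HasDerivAt (fun x ↦ (Real.exp x - 1)⁻¹) (-(Real.exp x) / (Real.exp x - 1) ^ 2) x :=
    h1.inv hne
  have h3 : HasDerivAt (fun x : ℝ ↦ x⁻¹) (-(x ^ 2)⁻¹) x := hasDerivAt_inv hx.ne'
  exact (h2.sub h3).congr_deriv (by ring)

/-- `r′ ≥ 0` on `(0, ∞)`: `x² eˣ ≤ (eˣ − 1)²`. [folklore] -/
theorem rFun_deriv_nonneg {x : ℝ} (hx : 0 < x) :
    0 ≤ -(Real.exp x) / (Real.exp x - 1) ^ 2 + (x ^ 2)⁻¹ := by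
  have hpos : 0 < Real.exp x - 1 := (sub_pos.2 (Real.one_lt_exp_iff.2 hx))
  have hk := sq_le_exp_add_exp_neg_sub_two hx.le
  -- (eˣ − 1)² = eˣ (eˣ + e⁻ˣ − 2)
  have hid : (Real.exp x - 1) ^ 2 = Real.exp x * (Real.exp x + Real.exp (-x) - 2) := by
    have : Real.exp x * Real.exp (-x) = 1 := by rw [← Real.exp_add, add_neg_cancel, Real.exp_zero]
    nlinarith [this]
  have hmain : Real.exp x * x ^ 2 ≤ (Real.exp x - 1) ^ 2 := by
    rw [hid]
    exact mul_le_mul_of_nonneg_left hk (Real.exp_pos x).le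
  have h1 : Real.exp x / (Real.exp x - 1) ^ 2 ≤ (x ^ 2)⁻¹ := by
    rw [inv_eq_one_div, div_le_div_iff₀ (by positivity) (by positivity)]
    linarith
  have h2 : -(Real.exp x) / (Real.exp x - 1) ^ 2 = -(Real.exp x / (Real.exp x - 1) ^ 2) :=
    neg_div _ _
  linarith

/-- `r` is continuous on `(0, ∞)`. [folklore] -/
theorem continuousOn_rFun : ContinuousOn rFun (Ioi 0) :=
  fun _ hx ↦ (hasDerivAt_rFun hx).continuousAt.continuousWithinAt

/-- **`r` is increasing on `(0, ∞)`.** [folklore] -/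
theorem monotoneOn_rFun : MonotoneOn rFun (Ioi 0) := by
  refine monotoneOn_of_deriv_nonneg (convex_Ioi 0) continuousOn_rFun ?_ ?_
  · rw [interior_Ioi]
    exact fun x hx ↦ (hasDerivAt_rFun hx).differentiableAt.differentiableWithinAt
  · rw [interior_Ioi]
    intro x hx
    rw [(hasDerivAt_rFun hx).deriv]
    exact rFun_deriv_nonneg hx

/-! ## The weight `𝒲` and the corner weight `E` -/

/-- **`𝒲(y) = ∫_0^∞ dv/(e^{v + y/v} − 1)`** — the diagonal cut-off weight of the mollified second
moment (`= Σ_{n ≥ 1} W(n² y)/n`, `W(y) = ∫_0^∞ e^{-u - y/u} du`, after `u = nv` and summing the geometric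
series). [cite: KowalskiMichelVanderKam2000, Prop. 5.1 — derivation (real form of the diagonal weight)] -/
def scriptW (y : ℝ) : ℝ := ∫ v in Ioi (0 : ℝ), (Real.exp (v + y / v) - 1)⁻¹

/-- **The corner weight `E(y) = 𝒲(y) − ½ log(1/y) = 𝒲(y) + ½ log y`**: true diagonal weight minus the
continued (`t = 0` residue) weight of `KMV2000.kmvKernel`. [cite: KowalskiMichelVanderKam2000, (21)–(23) and Prop. 5.1 — derivation] -/
def cornerE (y : ℝ) : ℝ := scriptW y + Real.log y / 2

/-- `v + y/v > 0` for `v > 0`, `y ≥ 0`. [folklore] -/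
theorem phi_pos {y v : ℝ} (hy : 0 ≤ y) (hv : 0 < v) : 0 < v + y / v := by
  have : 0 ≤ y / v := div_nonneg hy hv.le
  linarith

/-- The integrand of `𝒲` is non-negative. [folklore] -/
theorem scriptW_integrand_nonneg {y v : ℝ} (hy : 0 ≤ y) (hv : 0 < v) :
    0 ≤ (Real.exp (v + y / v) - 1)⁻¹ :=
  (inv_pos.2 ((sub_pos.2 (Real.one_lt_exp_iff.2 (phi_pos hy hv))))).le

/-- The integrand of `𝒲` is dominated by `1/(eᵛ − 1)`. [folklore] -/
theorem scriptW_integrand_le_exp {y v : ℝ} (hy : 0 ≤ y) (hv : 0 < v) :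
    (Real.exp (v + y / v) - 1)⁻¹ ≤ (Real.exp v - 1)⁻¹ := by
  rw [inv_le_inv₀ ((sub_pos.2 (Real.one_lt_exp_iff.2 (phi_pos hy hv)))) ((sub_pos.2 (Real.one_lt_exp_iff.2 hv)))]
  have : v ≤ v + y / v := by have : 0 ≤ y / v := div_nonneg hy hv.le; linarith
  have := Real.exp_le_exp.2 this
  linarith

/-- The integrand of `𝒲` is monotone in `y`. [folklore] -/
theorem scriptW_integrand_anti {y₁ y₂ v : ℝ} (hy₁ : 0 ≤ y₁) (h : y₁ ≤ y₂) (hv : 0 < v) :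
    (Real.exp (v + y₂ / v) - 1)⁻¹ ≤ (Real.exp (v + y₁ / v) - 1)⁻¹ := by
  rw [inv_le_inv₀ ((sub_pos.2 (Real.one_lt_exp_iff.2 (phi_pos (hy₁.trans h) hv)))) ((sub_pos.2 (Real.one_lt_exp_iff.2 (phi_pos hy₁ hv))))]
  have : v + y₁ / v ≤ v + y₂ / v := by
    have := div_le_div_of_nonneg_right h hv.le
    linarith
  have := Real.exp_le_exp.2 this
  linarith

/-- `1/(eᵛ − 1) ≤ 2 e^{−v}` for `v ≥ 1`. [folklore] -/
theorem inv_exp_sub_one_le {v : ℝ} (hv : 1 ≤ v) : (Real.exp v - 1)⁻¹ ≤ 2 * Real.exp (-v) := by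
  have he : 2 ≤ Real.exp v := by
    have h1 : (2 : ℝ) ≤ 1 + 1 := by norm_num
    have := Real.add_one_le_exp v
    linarith
  have hpos : 0 < Real.exp v - 1 := by linarith
  have hpos' : 0 < Real.exp v := Real.exp_pos v
  rw [Real.exp_neg, show (2 : ℝ) * (Real.exp v)⁻¹ = 2 / Real.exp v by rw [div_eq_mul_inv],
    inv_eq_one_div, div_le_div_iff₀ hpos hpos']
  linarith

/-- By AM–GM, `v + y/v ≥ 2√y`, so the integrand of `𝒲` is bounded by the constant `1/(e^{2√y} − 1)`.
[folklore] -/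
theorem scriptW_integrand_le_const {y v : ℝ} (hy : 0 < y) (hv : 0 < v) :
    (Real.exp (v + y / v) - 1)⁻¹ ≤ (Real.exp (2 * Real.sqrt y) - 1)⁻¹ := by
  have hs : 0 < Real.sqrt y := Real.sqrt_pos.2 hy
  rw [inv_le_inv₀ ((sub_pos.2 (Real.one_lt_exp_iff.2 (phi_pos hy.le hv)))) ((sub_pos.2 (Real.one_lt_exp_iff.2 (by positivity))))]
  have hamgm : 2 * Real.sqrt y ≤ v + y / v := by
    have hsq : Real.sqrt y * Real.sqrt y = y := Real.mul_self_sqrt hy.le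
    have h1 : 0 ≤ (v - Real.sqrt y) ^ 2 / v := div_nonneg (sq_nonneg _) hv.le
    have h2 : (v - Real.sqrt y) ^ 2 / v = v + y / v - 2 * Real.sqrt y := by
      field_simp
      nlinarith [hsq]
    linarith
  have := Real.exp_le_exp.2 hamgm
  linarith

/-- The integrand of `𝒲` is continuous on `(0, ∞)` (`y ≥ 0`). [folklore] -/
theorem continuousOn_scriptW_integrand {y : ℝ} (hy : 0 ≤ y) :
    ContinuousOn (fun v : ℝ ↦ (Real.exp (v + y / v) - 1)⁻¹) (Ioi 0) := by
  intro v hv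
  have hv0 : (v : ℝ) ≠ 0 := ne_of_gt hv
  have hc : ContinuousAt (fun v : ℝ ↦ Real.exp (v + y / v) - 1) v :=
    ((continuousAt_id.add (continuousAt_const.div continuousAt_id hv0)).rexp).sub
      continuousAt_const
  exact (hc.inv₀ ((sub_pos.2 (Real.one_lt_exp_iff.2 (phi_pos hy hv)))).ne').continuousWithinAt

/-! ## Integrability of the three kernels -/

/-- The integrand of `𝒲` is measurable (all of Mathlib's junk conventions included). [folklore] -/
theorem measurable_scriptW_integrand (y : ℝ) :
    Measurable (fun v : ℝ ↦ (Real.exp (v + y / v) - 1)⁻¹) := by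
  fun_prop

/-- **`v ↦ 1/(e^{v+y/v} − 1)` is integrable on `(0, ∞)`** (`y > 0`): bounded by a constant on `(0,1]`
(AM–GM) and by `2e^{−v}` on `(1, ∞)`. [folklore] -/
theorem integrableOn_scriptW {y : ℝ} (hy : 0 < y) :
    IntegrableOn (fun v : ℝ ↦ (Real.exp (v + y / v) - 1)⁻¹) (Ioi 0) := by
  have hmeas := measurable_scriptW_integrand y
  have h1 : IntegrableOn (fun v : ℝ ↦ (Real.exp (v + y / v) - 1)⁻¹) (Ioc 0 1) := by
    refine Measure.integrableOn_of_bounded (M := (Real.exp (2 * Real.sqrt y) - 1)⁻¹)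
      measure_Ioc_lt_top.ne hmeas.aestronglyMeasurable ?_
    rw [ae_restrict_iff' measurableSet_Ioc]
    refine ae_of_all _ fun v hv ↦ ?_
    rw [Real.norm_eq_abs, abs_of_nonneg (scriptW_integrand_nonneg hy.le hv.1)]
    exact scriptW_integrand_le_const hy hv.1
  have h2 : IntegrableOn (fun v : ℝ ↦ (Real.exp (v + y / v) - 1)⁻¹) (Ioi 1) := by
    have hg : IntegrableOn (fun v : ℝ ↦ 2 * Real.exp (-1 * v)) (Ioi 1) :=
      (exp_neg_integrableOn_Ioi 1 zero_lt_one).const_mul 2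
    refine Integrable.mono' hg hmeas.aestronglyMeasurable ?_
    rw [ae_restrict_iff' measurableSet_Ioi]
    refine ae_of_all _ fun v (hv : 1 < v) ↦ ?_
    have hv0 : 0 < v := by linarith
    rw [Real.norm_eq_abs, abs_of_nonneg (scriptW_integrand_nonneg hy.le hv0), neg_one_mul]
    exact (scriptW_integrand_le_exp hy.le hv0).trans (inv_exp_sub_one_le hv.le)
  have := h1.union h2
  rwa [Ioc_union_Ioi_eq_Ioi zero_le_one] at this

/-- `𝒲(y) ≥ 0`. [folklore] -/
theorem scriptW_nonneg {y : ℝ} (hy : 0 ≤ y) : 0 ≤ scriptW y :=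
  setIntegral_nonneg measurableSet_Ioi fun _ hv ↦ scriptW_integrand_nonneg hy hv

/-- `𝒲` is decreasing on `(0, ∞)`. [folklore] -/
theorem scriptW_anti {y₁ y₂ : ℝ} (hy₁ : 0 < y₁) (h : y₁ ≤ y₂) : scriptW y₂ ≤ scriptW y₁ :=
  setIntegral_mono_on (integrableOn_scriptW (hy₁.trans_le h)) (integrableOn_scriptW hy₁)
    measurableSet_Ioi fun _ hv ↦ scriptW_integrand_anti hy₁.le h hv

/-- The second kernel `b₂(v) = v/(v²+y) − v/(v²+1)` is the derivative of
`F₂(v) = ½(log(v²+y) − log(v²+1))`. [folklore] -/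
theorem hasDerivAt_logQuad {y : ℝ} (hy : 0 < y) (v : ℝ) :
    HasDerivAt (fun v : ℝ ↦ (Real.log (v ^ 2 + y) - Real.log (v ^ 2 + 1)) / 2)
      (v / (v ^ 2 + y) - v / (v ^ 2 + 1)) v := by
  have hsq : HasDerivAt (fun v : ℝ ↦ v ^ 2) (2 * v) v := by simpa using hasDerivAt_pow 2 v
  have hy' : v ^ 2 + y ≠ 0 := by positivity
  have h1' : (v : ℝ) ^ 2 + 1 ≠ 0 := by positivity
  have h1 : HasDerivAt (fun v : ℝ ↦ Real.log (v ^ 2 + y)) ((2 * v + 0) / (v ^ 2 + y)) v :=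
    (hsq.add (hasDerivAt_const v y)).log hy'
  have h2 : HasDerivAt (fun v : ℝ ↦ Real.log (v ^ 2 + 1)) ((2 * v + 0) / (v ^ 2 + 1)) v :=
    (hsq.add (hasDerivAt_const v (1 : ℝ))).log h1'
  have h3 := (h1.sub h2).div_const 2
  refine h3.congr_deriv ?_
  field_simp
  ring

/-- `F₂(v) → 0` as `v → ∞`. [folklore] -/
theorem tendsto_logQuad {y : ℝ} (hy : 0 < y) :
    Tendsto (fun v : ℝ ↦ (Real.log (v ^ 2 + y) - Real.log (v ^ 2 + 1)) / 2) atTop (𝓝 0) := by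
  -- (v²+y)/(v²+1) = 1 + (y-1)/(v²+1) → 1
  have hq : Tendsto (fun v : ℝ ↦ v ^ 2 + 1) atTop atTop :=
    tendsto_atTop_add_const_right _ 1 (tendsto_pow_atTop two_ne_zero)
  have h1 : Tendsto (fun v : ℝ ↦ 1 + (y - 1) / (v ^ 2 + 1)) atTop (𝓝 (1 + 0)) :=
    tendsto_const_nhds.add (tendsto_const_nhds.div_atTop hq)
  rw [add_zero] at h1
  have h2 : Tendsto (fun v : ℝ ↦ Real.log (1 + (y - 1) / (v ^ 2 + 1))) atTop (𝓝 0) := by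
    have := (Real.continuousAt_log one_ne_zero).tendsto.comp h1
    rw [Real.log_one] at this
    exact this
  have h3 : Tendsto (fun v : ℝ ↦ Real.log (1 + (y - 1) / (v ^ 2 + 1)) / 2) atTop (𝓝 0) := by
    simpa using h2.div_const 2
  refine h3.congr fun v ↦ ?_
  have hv1 : (v ^ 2 + 1) ≠ 0 := by positivity
  have hvy : (v ^ 2 + y) ≠ 0 := by positivity
  rw [show 1 + (y - 1) / (v ^ 2 + 1) = (v ^ 2 + y) / (v ^ 2 + 1) by field_simp; ring,
    Real.log_div hvy hv1]

/-- `b₂` is integrable on `(0, ∞)` (it has constant sign, and `F₂` has a limit). [folklore] -/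
theorem integrableOn_logQuad_deriv {y : ℝ} (hy : 0 < y) :
    IntegrableOn (fun v : ℝ ↦ v / (v ^ 2 + y) - v / (v ^ 2 + 1)) (Ioi 0) := by
  rcases le_total y 1 with h | h
  · refine integrableOn_Ioi_deriv_of_nonneg' (fun v _ ↦ hasDerivAt_logQuad hy v) ?_ (tendsto_logQuad hy)
    intro v (hv : 0 < v)
    have : v / (v ^ 2 + 1) ≤ v / (v ^ 2 + y) :=
      div_le_div_of_nonneg_left hv.le (by positivity) (by linarith)
    linarith
  · refine integrableOn_Ioi_deriv_of_nonpos' (fun v _ ↦ hasDerivAt_logQuad hy v) ?_ (tendsto_logQuad hy)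
    intro v (hv : 0 < v)
    have : v / (v ^ 2 + y) ≤ v / (v ^ 2 + 1) :=
      div_le_div_of_nonneg_left hv.le (by positivity) (by linarith)
    linarith

/-- **`∫_0^∞ [v/(v²+y) − v/(v²+1)] dv = −½ log y`.** [folklore] -/
theorem integral_logQuad_deriv {y : ℝ} (hy : 0 < y) :
    ∫ v in Ioi (0 : ℝ), (v / (v ^ 2 + y) - v / (v ^ 2 + 1)) = -(Real.log y / 2) := by
  rw [integral_Ioi_of_hasDerivAt_of_tendsto' (fun v _ ↦ hasDerivAt_logQuad hy v)
    (integrableOn_logQuad_deriv hy) (tendsto_logQuad hy)]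
  simp

end Summit.Parity.GeneralizedHardyLittlewood.Theorems.BeyondDiagonalBeatsQuarter.Corner
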